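import Summits.ResolutionOfSingularities.ResolutionOfSingularities.Theorems.PurelyInseparableDim4MohAlong
import HarnessLib

/-!
# The order along a KEPT coordinate subspace does not drop under a coordinate-centre step («L-proj»; cell `res-dim4-pi`,
# F4-C coordinate game / CARD I-2-14's mechanism, typed as a lemma WITHOUT the optimality corollary)

[OURS · counted 0 · cell `res-dim4-pi` · seat res-dim4-p-11 g5 (PR-1 «Moh along the centre» lineage; the polynomial identity res-dim4-crit-3 g7
asked to have typed, T-A3-48 (3), bus 2026-08-29 12:54Z).]  Nothing here proves `TerminatesInScope 2 2`, any optimality law of the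
coordinate game, or resolution of singularities in dimension ≥ 4 / characteristic `p` — NOT proved.  AI kernel work, weaker than expert
review.

For a coordinate subspace `V(x_S)` and a step of the coordinate-centre walk along ANY centre `V(x_T)` in a chart `x_j` with `j ∉ S`, at a
point `b` of the exceptional divisor lying over `V(x_S)` (`b_i = 0` for `i ∈ S`): the `S`-degree of every monomial is unchanged by the
chart law (`chartExponent q T j d` agrees with `d` off `j`), by the translation (supported off `S`, `MohAlong.ordAlong_translate`) and can
only rise under cleaning (monomials are deleted, never created).  Hence

* `ordAlong_le_ordAlong_chartTransform_of_not_mem` — `ordAlong S F ≤ ordAlong S (chartTransform q T j F)` for `j ∉ S`;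
* `ordAlong_le_ordAlong_deletePthPowers` — `ordAlong S P ≤ ordAlong S (deletePthPowers q P)`;
* **`ordAlong_le_ordAlong_step_of_not_mem`** — `ordAlong S s.F ≤ ordAlong S (CentreBlowup.step q T j b s).F` (`j ∉ S`, `b|_S = 0`);
* **`equimultiple_kept`** — if `V(x_S)` is `q`-fold for `x^q + s.F` (`q ≤ ordAlong S s.F`) then it is `q`-fold for the child.

The optimality inference of CARD I-2-14 (C⁺) does NOT follow and is not claimed (crit-3 T-A3-48: located counterexamples).
[cite: HauserPerlega2019PRIMS, §2 (permissible blowups, `ord_P`, the blowup in the x₁-chart)] [cite: Hauser2010, §§F–G]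
bears_on: LADDER-RESOLUTION:D157-DOOR2 (res-dim4-pi · F4-C coordinate game · L-proj).  Supports stmt-ResolutionOfSingularities-16155 (helper).
-/

set_option linter.dupNamespace false

noncomputable section

open MvPolynomial Finset

namespace Summit.ResolutionOfSingularities.ResolutionOfSingularities.Theorems.PIDim4

open Literature.AlgebraicGeometry.Resolution
open Literature.AlgebraicGeometry.Resolution.Hauser2010
open Literature.AlgebraicGeometry.Resolution.CentreBlowup

namespace MohAlong

section Kept

variable {σ : Type*} {K : Type*} [Field K] [Fintype σ] [DecidableEq σ]

omit [Fintype σ] in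
/-- The chart law leaves the `S`-degree of an exponent unchanged when the chart letter is not in `S`. [folklore] -/
theorem degIn_chartExponent_of_not_mem {S : Finset σ} {j : σ} (hjS : j ∉ S) (q : ℕ) (T : Finset σ) (d : σ →₀ ℕ) :
    degIn S (chartExponent q T j d) = degIn S d :=
  degIn_eq_of_forall fun _ hi => chartExponent_apply_of_ne q T (ne_of_mem_of_not_mem hi hjS) d

omit [Fintype σ] in
/-- **The order along `V(x_S)` does not drop under the chart transform of ANY coordinate centre in a chart `x_j`, `j ∉ S`.**
[cite: HauserPerlega2019PRIMS, §2 (the blowup in the x₁-chart)] -/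
theorem ordAlong_le_ordAlong_chartTransform_of_not_mem {S : Finset σ} {j : σ} (hjS : j ∉ S) (q : ℕ) (T : Finset σ)
    (F : MvPolynomial σ K) : ordAlong S F ≤ ordAlong S (chartTransform q T j F) := by
  classical
  refine le_ordAlong_iff.mpr fun β hβ => ?_
  -- `β` is the chart image of a monomial of `F`
  unfold chartTransform at hβ
  obtain ⟨d, hd, hβd⟩ := Finset.mem_biUnion.mp (MvPolynomial.support_sum hβ)
  have hβeq : β = chartExponent q T j d := by
    have := support_monomial_subset hβd
    rwa [Finset.mem_singleton] at this
  rw [hβeq, degIn_chartExponent_of_not_mem hjS]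
  exact ordAlong_le_of_mem_support hd

omit [Fintype σ] in
/-- **Cleaning only deletes monomials**, so the order along every `V(x_S)` can only rise. [cite: Hauser2010, §§F–G] -/
theorem ordAlong_le_ordAlong_deletePthPowers (q : ℕ) (S : Finset σ) (P : MvPolynomial σ K) :
    ordAlong S P ≤ ordAlong S (deletePthPowers q P) :=
  le_ordAlong_iff.mpr fun _ hβ => ordAlong_le_of_mem_support (mem_support_of_mem_support_deletePthPowers q hβ).1

variable [DecidableEq K]

/-- **«L-proj»: the order along a KEPT coordinate subspace does not drop.**  For a step of the coordinate-centre walk along any centre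
`V(x_T)`, chart `x_j` with `j ∉ S`, at a point `b` with `b_i = 0` for all `i ∈ S`:
`ordAlong S s.F ≤ ordAlong S (step q T j b s).F`. [cite: HauserPerlega2019PRIMS, §2] [cite: Hauser2010, §§F–G] -/
theorem ordAlong_le_ordAlong_step_of_not_mem {S : Finset σ} {j : σ} (hjS : j ∉ S) (q : ℕ) (T : Finset σ)
    {b : σ → K} (hb : ∀ i ∈ S, b i = 0) (s : CState σ K) :
    ordAlong S s.F ≤ ordAlong S (CentreBlowup.step q T j b s).F := by
  change ordAlong S s.F ≤ ordAlong S (deletePthPowers q (PointBlowup.translate b (chartTransform q T j s.F)))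
  calc ordAlong S s.F ≤ ordAlong S (chartTransform q T j s.F) := ordAlong_le_ordAlong_chartTransform_of_not_mem hjS q T s.F
    _ = ordAlong S (PointBlowup.translate b (chartTransform q T j s.F)) := (ordAlong_translate b hb _).symm
    _ ≤ _ := ordAlong_le_ordAlong_deletePthPowers q S _

/-- **A kept equimultiple coordinate subspace stays equimultiple**: if `V(x_S)` is `q`-fold for `x^q + s.F` (`q ≤ ordAlong S s.F`), then it
is `q`-fold for the child of every step in a chart `x_j`, `j ∉ S`, at a point over `V(x_S)`.  No statement about the OPTIMALITY of any
centre is made or implied. [cite: HauserPerlega2019PRIMS, §2 (permissible blowups)] -/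
theorem equimultiple_kept {S : Finset σ} {j : σ} (hjS : j ∉ S) {q : ℕ} (T : Finset σ) {b : σ → K} (hb : ∀ i ∈ S, b i = 0)
    {s : CState σ K} (hS : (q : ℕ∞) ≤ ordAlong S s.F) : (q : ℕ∞) ≤ ordAlong S (CentreBlowup.step q T j b s).F :=
  hS.trans (ordAlong_le_ordAlong_step_of_not_mem hjS q T hb s)

end Kept

end MohAlong

end Summit.ResolutionOfSingularities.ResolutionOfSingularities.Theorems.PIDim4

end
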